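import Literature.NumberTheory.Transcendental.NesterenkoGenericDegree
import Mathlib.FieldTheory.Perfect
import Mathlib.RingTheory.Localization.Integral
import Mathlib.Algebra.MvPolynomial.PDeriv
import Mathlib.Algebra.MvPolynomial.Funext
import HarnessLib

/-!
# Hilbert function of a space curve on a complete intersection, III: a Bézout identity for the Chow form (crux `ApproximationProperty`, stub `CycleAPIAt3`)

Crux `stmt-Schanuel-6117` (`Summit.Schanuel.Schanuel.Theses.DiophantineDichotomy.ApproximationProperty`),
line `orbit-interpolation-determinant`, registered stub `CycleAPIAt3 : CycleAPIAt 3`; third file of the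
curve Hilbert-function lower bound (see `…CurveHilbertSection.lean`). Everything here is PROVED; no
definitions, no named facts.

Let `𝔭 ⊂ ℚ[x₀, …, x_m]` be a homogeneous prime of rank `s + 1` with a chart `x_j ∉ 𝔭`
(`𝒢 : GSec m`, tree `NesterenkoGenericSectionField.lean`) and `F = chowForm 𝔭 (s + 1)` its associated
form; `F⁺ ∈ A⁺[T]` is `F` with `u_{s+1,j}` made the variable `T` (`GSec.Fplus`, irreducible over
`Frac(A⁺)`, tree `NesterenkoGenericDegree.lean`). We prove:

* `CurveHilbert.exists_bezout_Fplus` — **a Bézout identity `a F⁺ + b (F⁺)' = c`, `c ∈ A⁺ ∖ 0`**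
  (an irreducible polynomial over a field of characteristic zero is separable; clear denominators).
* `CurveHilbert.exists_bezout_specialised` — its **specialisation**: substitute rational constants `v`
  for the variables of the first `s` groups and `x_k` (complex forms) for `u_{s+1,k}`; the associated
  form becomes the complex form `F_v = F(v; x̲)` of the linear section of `V(𝔭)` by the hyperplanes
  `v`, and for `v` outside the zeros of a non-zero polynomial `g` one gets complex polynomials
  `α, β, γ` with `α F_v + β ∂F_v/∂x_j = γ`, `γ ≠ 0` and `γ` free of `x_j` — the tool by which the
  sequel shows that `F_v` has no repeated linear factor (a generic linear section of a curve of
  degree `D` has `D` distinct points).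

Sources: Nesterenko–Philippon (eds.), LNM 1752, Ch. 3 Prop. 4.4; Hodge–Pedoe II, Ch. X §§6–8 (Cayley
form of a generic section); folklore (Gauss's lemma, separability in characteristic zero).
-/

set_option linter.dupNamespace false

noncomputable section

namespace Summit.Schanuel.Schanuel.Cruxes.ApproximationProperty.OrbitInterpolationDeterminant

open Literature.NumberTheory.Transcendental.Nesterenko MvPolynomial

namespace CurveHilbert

variable {m : ℕ} (𝒢 : GSec m)

/-! ## The Bézout identity in `A⁺[T]` -/

/-- **`a F⁺ + b (F⁺)' = c` with `c ∈ A⁺ ∖ 0`**: `F⁺` is irreducible over the field `Frac(A⁺)` of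
characteristic zero, hence separable there; clearing denominators gives the identity over `A⁺`.
[folklore] -/
theorem exists_bezout_Fplus : ∃ (a b : Polynomial 𝒢.Ap) (c : 𝒢.Ap), c ≠ 0 ∧
    a * 𝒢.Fplus + b * Polynomial.derivative 𝒢.Fplus = Polynomial.C c := by
  classical
  have hsep : (𝒢.Fplus.map (algebraMap 𝒢.Ap 𝒢.Kpp)).Separable :=
    PerfectField.separable_of_irreducible 𝒢.irreducible_Fplus_map
  obtain ⟨a', b', hab⟩ := hsep
  rw [Polynomial.derivative_map] at hab
  obtain ⟨da, hda, ha⟩ := IsLocalization.integerNormalization_spec (nonZeroDivisors 𝒢.Ap) a'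
  obtain ⟨db, hdb, hb⟩ := IsLocalization.integerNormalization_spec (nonZeroDivisors 𝒢.Ap) b'
  refine ⟨IsLocalization.integerNormalization (nonZeroDivisors 𝒢.Ap) a' * Polynomial.C db,
    IsLocalization.integerNormalization (nonZeroDivisors 𝒢.Ap) b' * Polynomial.C da, da * db,
    mul_ne_zero (nonZeroDivisors.ne_zero hda) (nonZeroDivisors.ne_zero hdb), ?_⟩
  apply Polynomial.map_injective (algebraMap 𝒢.Ap 𝒢.Kpp) (IsFractionRing.injective 𝒢.Ap 𝒢.Kpp)
  rw [Polynomial.map_add, Polynomial.map_mul, Polynomial.map_mul, Polynomial.map_mul,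
    Polynomial.map_mul, Polynomial.map_C, Polynomial.map_C, Polynomial.map_C,
    ha, hb, ← IsScalarTower.algebraMap_smul 𝒢.Kpp da,
    ← IsScalarTower.algebraMap_smul 𝒢.Kpp db, Polynomial.smul_eq_C_mul, Polynomial.smul_eq_C_mul,
    map_mul, Polynomial.C_mul]
  linear_combination
    (Polynomial.C (algebraMap 𝒢.Ap 𝒢.Kpp da) * Polynomial.C (algebraMap 𝒢.Ap 𝒢.Kpp db)) * hab

/-! ## Specialising the first `s` groups to constants -/

/-- Differentiating a specialised polynomial: if `φ : A → ℂ[x̲]` kills `∂/∂x_j` (its values do not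
involve `x_j`), then `∂/∂x_j (g(φ; x_j)) = g'(φ; x_j)` for every `g ∈ A[T]`. [folklore] -/
theorem pderiv_eval₂ {A : Type*} [CommRing A] (φ : A →+* MvPolynomial (Fin (m + 1)) ℂ)
    (j : Fin (m + 1)) (hφ : ∀ c, pderiv j (φ c) = 0) (g : Polynomial A) :
    pderiv j (Polynomial.eval₂ φ (X j) g) = Polynomial.eval₂ φ (X j) (Polynomial.derivative g) := by
  induction g using Polynomial.induction_on' with
  | add p q hp hq =>
    rw [Polynomial.eval₂_add, map_add, hp, hq, Polynomial.derivative_add, Polynomial.eval₂_add]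
  | monomial n a =>
    rw [Polynomial.eval₂_monomial, Polynomial.derivative_monomial, Polynomial.eval₂_monomial,
      Derivation.leibniz, Derivation.leibniz_pow, pderiv_X_self, hφ, smul_zero, add_zero, map_mul,
      map_natCast, smul_eq_mul, smul_eq_mul, mul_one, nsmul_eq_mul]
    ring

/-- The substitution `θ` (last group `↦ x̲`, first groups `↦` constants) seen on `A⁺`: the image of
every `c ∈ A⁺` is killed by `∂/∂x_j` and does not involve `x_j`. [folklore] -/
theorem pderiv_aeval_Ap_eq_zero (θ : Fin (𝒢.s + 1) × Fin (m + 1) → MvPolynomial (Fin (m + 1)) ℂ)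
    (hθX : ∀ k, θ (Fin.last 𝒢.s, k) = X k)
    (hθC : ∀ w, w.1 ≠ Fin.last 𝒢.s → ∃ q : ℚ, θ w = C (q : ℂ)) (c : 𝒢.Ap) :
    pderiv 𝒢.j (aeval (fun w : 𝒢.Vp => θ w.1) c) = 0 ∧
      degreeOf 𝒢.j (aeval (fun w : 𝒢.Vp => θ w.1) c) = 0 := by
  classical
  -- the images of the variables
  have hvar : ∀ w : 𝒢.Vp, pderiv 𝒢.j (θ w.1) = 0 ∧ degreeOf 𝒢.j (θ w.1) = 0 := by
    intro w
    by_cases hw : w.1.1 = Fin.last 𝒢.s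
    · have hk : w.1.2 ≠ 𝒢.j := by
        intro hk
        exact w.2 (Prod.ext hw hk)
      have hw1 : w.1 = (Fin.last 𝒢.s, w.1.2) := Prod.ext hw rfl
      rw [hw1, hθX]
      exact ⟨pderiv_X_of_ne hk, by rw [degreeOf_X, if_neg (Ne.symm hk)]⟩
    · obtain ⟨q, hq⟩ := hθC w.1 hw
      rw [hq]
      exact ⟨pderiv_C, degreeOf_C _ _⟩
  induction c using MvPolynomial.induction_on with
  | C a =>
    rw [algHom_C, MvPolynomial.algebraMap_apply]
    exact ⟨pderiv_C, degreeOf_C _ _⟩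
  | add p q hp hq =>
    rw [map_add, map_add]
    refine ⟨by rw [hp.1, hq.1, add_zero], Nat.eq_zero_of_le_zero ?_⟩
    exact (degreeOf_add_le _ _ _).trans (by rw [hp.2, hq.2, max_self])
  | mul_X p w hp =>
    rw [map_mul, aeval_X]
    refine ⟨by rw [Derivation.leibniz, (hvar w).1, hp.1, smul_zero, smul_zero, add_zero],
      Nat.eq_zero_of_le_zero ?_⟩
    exact (degreeOf_mul_le _ _ _).trans (by rw [hp.2, (hvar w).2])

/-- **The specialised associated form is `F⁺` evaluated**: with `θ` as above (and
`θ(u_{s+1,j}) = x_j`), `F⁺(θ|A⁺; x_j) = F(θ)`. [folklore] -/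
theorem eval₂_Fplus (θ : Fin (𝒢.s + 1) × Fin (m + 1) → MvPolynomial (Fin (m + 1)) ℂ)
    (hθX : ∀ k, θ (Fin.last 𝒢.s, k) = X k) :
    Polynomial.eval₂ (aeval fun w : 𝒢.Vp => θ w.1).toRingHom (X 𝒢.j) 𝒢.Fplus =
      aeval θ (chowForm 𝒢.𝔭 (𝒢.s + 1)) := by
  have h : ((Polynomial.eval₂RingHom (aeval fun w : 𝒢.Vp => θ w.1).toRingHom (X 𝒢.j)).comp
        (𝒢.splitEquiv : RU (𝒢.s + 1) m →+* Polynomial 𝒢.Ap)) =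
      (aeval θ : RU (𝒢.s + 1) m →ₐ[ℚ] MvPolynomial (Fin (m + 1)) ℂ).toRingHom := by
    refine MvPolynomial.ringHom_ext (fun a => ?_) (fun w => ?_)
    · simp only [RingHom.comp_apply, RingHom.coe_coe, Polynomial.coe_eval₂RingHom,
        AlgHom.toRingHom_eq_coe]
      rw [← MvPolynomial.algebraMap_eq, AlgEquiv.commutes, Polynomial.algebraMap_apply,
        Polynomial.eval₂_C, RingHom.coe_coe, AlgHom.commutes, AlgHom.commutes]
    · simp only [RingHom.comp_apply, RingHom.coe_coe, Polynomial.coe_eval₂RingHom,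
        AlgHom.toRingHom_eq_coe, aeval_X]
      by_cases hw : w = (Fin.last 𝒢.s, 𝒢.j)
      · subst hw
        rw [GSec.splitEquiv_X_self, Polynomial.eval₂_X, hθX]
      · rw [𝒢.splitEquiv_X_of_ne hw, Polynomial.eval₂_C, RingHom.coe_coe, aeval_X]
  have := RingHom.congr_fun h (chowForm 𝒢.𝔭 (𝒢.s + 1))
  show Polynomial.eval₂ _ (X 𝒢.j) (𝒢.splitEquiv (chowForm 𝒢.𝔭 (𝒢.s + 1))) = _
  simpa only [RingHom.comp_apply, RingHom.coe_coe, Polynomial.coe_eval₂RingHom,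
    AlgHom.toRingHom_eq_coe] using this

/-- **Genericity**: for `c ∈ A⁺ ∖ 0` there is a non-zero rational polynomial `g` in the variables
`U` such that for every rational point `v` off `g = 0`, the specialisation `θ_v` (first `s` groups
`↦ v`, last group `↦ x̲`) does not kill `c`. [folklore] -/
theorem exists_generic_aeval_ne_zero {c : 𝒢.Ap} (hc : c ≠ 0) :
    ∃ g : MvPolynomial (Fin (𝒢.s + 1) × Fin (m + 1)) ℚ, g ≠ 0 ∧
      ∀ (v : Fin (𝒢.s + 1) × Fin (m + 1) → ℚ)
        (θ : Fin (𝒢.s + 1) × Fin (m + 1) → MvPolynomial (Fin (m + 1)) ℂ),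
        (∀ k, θ (Fin.last 𝒢.s, k) = X k) → (∀ w, w.1 ≠ Fin.last 𝒢.s → θ w = C ((v w : ℚ) : ℂ)) →
        eval v g ≠ 0 → aeval (fun w : 𝒢.Vp => θ w.1) c ≠ 0 := by
  classical
  -- a rational point where `c` does not vanish
  obtain ⟨z, hz⟩ : ∃ z : 𝒢.Vp → ℚ, eval z c ≠ 0 := by
    by_contra h
    push Not at h
    exact hc (MvPolynomial.funext fun z => by rw [h z, map_zero])
  -- `g`: the last group evaluated at `z`, the other variables kept
  let ψ : 𝒢.Vp → MvPolynomial (Fin (𝒢.s + 1) × Fin (m + 1)) ℚ :=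
    fun w => if w.1.1 = Fin.last 𝒢.s then C (z w) else X w.1
  refine ⟨aeval ψ c, ?_, ?_⟩
  · -- `g ≠ 0`: at `v₀ = z` (off the pivot variable) it takes the value `c(z) ≠ 0`
    let v₀ : Fin (𝒢.s + 1) × Fin (m + 1) → ℚ :=
      fun w => if h : w = (Fin.last 𝒢.s, 𝒢.j) then 0 else z ⟨w, h⟩
    intro hg
    apply hz
    have hfun : (fun w => aeval v₀ (ψ w)) = z := by
      funext w
      by_cases hw : w.1.1 = Fin.last 𝒢.s
      · simp only [ψ, if_pos hw, aeval_C]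
        rfl
      · simp only [ψ, if_neg hw, aeval_X, v₀, dif_neg w.2]
    have h1 : aeval v₀ (aeval ψ c) = aeval z c := by
      rw [← AlgHom.comp_apply, comp_aeval, hfun]
    change aeval z c = 0
    rw [← h1, hg, map_zero]
  · intro v θ hθX hθC hg hzero
    apply hg
    -- evaluate at the complex point `u₀ = z|_{last group}`
    let u₀ : Fin (m + 1) → ℂ :=
      fun k => if h : (Fin.last 𝒢.s, k) = (Fin.last 𝒢.s, 𝒢.j) then 0 else ((z ⟨_, h⟩ : ℚ) : ℂ)
    let z' : 𝒢.Vp → ℚ := fun w => if w.1.1 = Fin.last 𝒢.s then z w else v w.1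
    have h1 : eval u₀ (aeval (fun w : 𝒢.Vp => θ w.1) c) = algebraMap ℚ ℂ (eval z' c) := by
      rw [map_aeval, show eval z' c = eval₂ (RingHom.id ℚ) z' c from rfl,
        eval₂_comp_left (algebraMap ℚ ℂ) (RingHom.id ℚ) z' c, coe_eval₂Hom]
      congr 1
      · exact RingHom.ext fun q => by simp
      · funext w
        by_cases hw : w.1.1 = Fin.last 𝒢.s
        · have hw1 : w.1 = (Fin.last 𝒢.s, w.1.2) := Prod.ext hw rfl
          have hk : (Fin.last 𝒢.s, w.1.2) ≠ (Fin.last 𝒢.s, 𝒢.j) := hw1 ▸ w.2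
          have hzw : z ⟨(Fin.last 𝒢.s, w.1.2), hk⟩ = z w := congrArg z (Subtype.ext hw1.symm)
          simp only [Function.comp_apply, z', if_pos hw]
          rw [hw1, hθX, eval_X]
          simp only [u₀, dif_neg hk, hzw, eq_ratCast]
        · have hq := hθC w.1 hw
          simp only [Function.comp_apply, z', if_neg hw, hq, eval_C, eq_ratCast]
    have hfun : (fun w => aeval v (ψ w)) = z' := by
      funext w
      by_cases hw : w.1.1 = Fin.last 𝒢.s
      · simp only [ψ, z', if_pos hw, aeval_C]
        rfl
      · simp only [ψ, z', if_neg hw, aeval_X]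
    have h2 : eval v (aeval ψ c) = eval z' c := by
      change aeval v (aeval ψ c) = aeval z' c
      rw [← AlgHom.comp_apply, comp_aeval, hfun]
    have h3 : algebraMap ℚ ℂ (eval z' c) = 0 := by rw [← h1, hzero, map_zero]
    rw [h2]
    exact (algebraMap ℚ ℂ).injective (h3.trans (map_zero _).symm)

/-- **The specialised Bézout identity.** There is a non-zero rational polynomial `g` in the variables
`U` such that for every rational point `v` off `g = 0` and every substitution `θ` with
`θ(u_{s+1,k}) = x_k` and `θ(u_{ik}) = v_{ik}` (`i ≤ s`), the complex form `F_v = F(θ)`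
(`F = chowForm 𝔭 (s+1)`) satisfies `α F_v + β ∂F_v/∂x_j = γ` for some complex polynomials
`α, β, γ` with `γ ≠ 0` not involving `x_j`. [folklore] -/
theorem exists_bezout_specialised :
    ∃ g : MvPolynomial (Fin (𝒢.s + 1) × Fin (m + 1)) ℚ, g ≠ 0 ∧
      ∀ (v : Fin (𝒢.s + 1) × Fin (m + 1) → ℚ)
        (θ : Fin (𝒢.s + 1) × Fin (m + 1) → MvPolynomial (Fin (m + 1)) ℂ),
        (∀ k, θ (Fin.last 𝒢.s, k) = X k) → (∀ w, w.1 ≠ Fin.last 𝒢.s → θ w = C ((v w : ℚ) : ℂ)) →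
        eval v g ≠ 0 →
        ∃ α β γ : MvPolynomial (Fin (m + 1)) ℂ,
          α * aeval θ (chowForm 𝒢.𝔭 (𝒢.s + 1)) +
              β * pderiv 𝒢.j (aeval θ (chowForm 𝒢.𝔭 (𝒢.s + 1))) = γ ∧
            γ ≠ 0 ∧ degreeOf 𝒢.j γ = 0 := by
  obtain ⟨a, b, c, hc, habc⟩ := exists_bezout_Fplus 𝒢
  obtain ⟨g, hg, hgen⟩ := exists_generic_aeval_ne_zero 𝒢 hc
  refine ⟨g, hg, fun v θ hθX hθC hv => ?_⟩
  let φ : 𝒢.Ap →+* MvPolynomial (Fin (m + 1)) ℂ := (aeval fun w : 𝒢.Vp => θ w.1).toRingHom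
  have hθC' : ∀ w, w.1 ≠ Fin.last 𝒢.s → ∃ q : ℚ, θ w = C (q : ℂ) := fun w hw => ⟨v w, hθC w hw⟩
  have hkill : ∀ c', pderiv 𝒢.j (φ c') = 0 := fun c' =>
    (pderiv_aeval_Ap_eq_zero 𝒢 θ hθX hθC' c').1
  have hF : Polynomial.eval₂ φ (X 𝒢.j) 𝒢.Fplus = aeval θ (chowForm 𝒢.𝔭 (𝒢.s + 1)) :=
    eval₂_Fplus 𝒢 θ hθX
  have hF' : Polynomial.eval₂ φ (X 𝒢.j) (Polynomial.derivative 𝒢.Fplus) =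
      pderiv 𝒢.j (aeval θ (chowForm 𝒢.𝔭 (𝒢.s + 1))) := by
    rw [← pderiv_eval₂ φ 𝒢.j hkill, hF]
  refine ⟨Polynomial.eval₂ φ (X 𝒢.j) a, Polynomial.eval₂ φ (X 𝒢.j) b, φ c, ?_, hgen v θ hθX hθC hv,
    (pderiv_aeval_Ap_eq_zero 𝒢 θ hθX hθC' c).2⟩
  have h := congrArg (Polynomial.eval₂ φ (X 𝒢.j)) habc
  rw [Polynomial.eval₂_add, Polynomial.eval₂_mul, Polynomial.eval₂_mul, Polynomial.eval₂_C, hF,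
    hF'] at h
  exact h

end CurveHilbert

/-- **The specialised Bézout identity for the associated form (registered helper
`curveHilbert_bezoutSpecialised`).** For a homogeneous prime `𝔭` of rank `s + 1` with a chart `x_j`
(`𝒢 : GSec m`) there is a non-zero rational polynomial `g` in the variables `U` such that for every
rational point `v` off `g = 0` and every substitution `θ` with `θ(u_{s+1,k}) = x_k` and
`θ(u_{ik}) = v_{ik}` (`i ≤ s`), the complex form `F_v = F(θ)`, `F = chowForm 𝔭 (s+1)`, satisfies
`α F_v + β ∂F_v/∂x_j = γ` with `γ ≠ 0` free of `x_j`. [folklore] -/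
theorem curveHilbert_bezoutSpecialised :
    ∀ (m : ℕ) (𝒢 : Literature.NumberTheory.Transcendental.Nesterenko.GSec m),
      ∃ g : MvPolynomial (Fin (𝒢.s + 1) × Fin (m + 1)) ℚ, g ≠ 0 ∧
        ∀ (v : Fin (𝒢.s + 1) × Fin (m + 1) → ℚ)
          (θ : Fin (𝒢.s + 1) × Fin (m + 1) → MvPolynomial (Fin (m + 1)) ℂ),
          (∀ k, θ (Fin.last 𝒢.s, k) = MvPolynomial.X k) →
          (∀ w, w.1 ≠ Fin.last 𝒢.s → θ w = MvPolynomial.C ((v w : ℚ) : ℂ)) →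
          MvPolynomial.eval v g ≠ 0 →
          ∃ α β γ : MvPolynomial (Fin (m + 1)) ℂ,
            α * MvPolynomial.aeval θ
                  (Literature.NumberTheory.Transcendental.Nesterenko.chowForm 𝒢.𝔭 (𝒢.s + 1)) +
                β * MvPolynomial.pderiv 𝒢.j (MvPolynomial.aeval θ
                  (Literature.NumberTheory.Transcendental.Nesterenko.chowForm 𝒢.𝔭 (𝒢.s + 1))) = γ ∧
              γ ≠ 0 ∧ MvPolynomial.degreeOf 𝒢.j γ = 0 :=
  fun _ 𝒢 => CurveHilbert.exists_bezout_specialised 𝒢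

end Summit.Schanuel.Schanuel.Cruxes.ApproximationProperty.OrbitInterpolationDeterminant

end
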